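import Summits.Ventures.HodgeRepro2.T5LevelCoinvariants

/-!
# Conjugation of levels (Tier-5 kernel support, seat p8)

For `g ∈ G` and the conjugate level `K^g := g K g⁻¹` (Mathlib's `K.map (MulAut.conj g)`),
`ρ g` carries `V^K` onto `V^{K^g}` (`map_invariants_conj`, an isomorphism of the invariants,
`finrank_invariants_conj`) and the augmentation submodule `V(K)` into `V(K^g)`
(`map_coinvariantsKer_conj_le`); consequently the level idempotents are conjugate:
`e_{K^g} (ρ g v) = ρ g (e_K v)` (`levelAverage_conj`), for `K`-finite levels in characteristic
`0`.  A characterisation of `e_K x` by its two defining properties is proved on the way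
(`levelAverage_eq_of_mem_of_sub_mem`).  This is the bookkeeping of «changing the level by
conjugation» (the passage between `K` and `g K g⁻¹` in double-coset computations).  Nothing is
asserted about any specific group.
-/

namespace Summit.Ventures.HodgeRepro2.T5LevelConjugation

open Summit.Ventures.HodgeRepro2.LevelPositivity Summit.Ventures.HodgeRepro2.T5LevelIdempotent
  Summit.Ventures.HodgeRepro2.T5LevelCoinvariants
open Representation (Coinvariants)

variable {G : Type*} [Group G] {k : Type*} [Field k] {V : Type*} [AddCommGroup V] [Module k V]
  (ρ : Representation k G V) (K : Subgroup G) (g : G)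

/-- `ρ g ∘ ρ g⁻¹ = 1`. -/
theorem apply_inv_apply (y : V) : ρ g (ρ g⁻¹ y) = y := by
  rw [← Module.End.mul_apply, ← map_mul, mul_inv_cancel, map_one, Module.End.one_apply]

/-- `ρ g⁻¹ ∘ ρ g = 1`. -/
theorem inv_apply_apply (y : V) : ρ g⁻¹ (ρ g y) = y := by
  rw [← Module.End.mul_apply, ← map_mul, inv_mul_cancel, map_one, Module.End.one_apply]

/-- Membership in the conjugate level `g K g⁻¹`. -/
theorem mem_conj_iff {h : G} : h ∈ K.map (MulAut.conj g).toMonoidHom ↔ g⁻¹ * h * g ∈ K := by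
  rw [Subgroup.mem_map_equiv, MulAut.conj_symm_apply]

/-- `g κ g⁻¹ ∈ K^g` for `κ ∈ K`. -/
theorem conj_mem_conj {κ : G} (hκ : κ ∈ K) : g * κ * g⁻¹ ∈ K.map (MulAut.conj g).toMonoidHom := by
  rw [mem_conj_iff]
  simpa [mul_assoc] using hκ

/-- `ρ g` carries `V^K` into `V^{K^g}`. -/
theorem apply_mem_invariants_conj {v : V} (hv : v ∈ invariants ρ K) :
    ρ g v ∈ invariants ρ (K.map (MulAut.conj g).toMonoidHom) := by
  rw [mem_invariants_iff] at hv ⊢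
  intro h hh
  rw [mem_conj_iff] at hh
  calc ρ h (ρ g v) = ρ g (ρ (g⁻¹ * h * g) v) := by
        simp only [map_mul, Module.End.mul_apply]
        rw [apply_inv_apply]
    _ = ρ g v := by rw [hv _ hh]

/-- `ρ g` carries `V^K` onto `V^{K^g}`. -/
theorem map_invariants_conj :
    (invariants ρ K).map (ρ g) = invariants ρ (K.map (MulAut.conj g).toMonoidHom) := by
  apply le_antisymm
  · intro x hx
    obtain ⟨v, hv, rfl⟩ := Submodule.mem_map.1 hx
    exact apply_mem_invariants_conj ρ K g hv
  · intro x hx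
    refine Submodule.mem_map.2 ⟨ρ g⁻¹ x, ?_, ?_⟩
    · rw [mem_invariants_iff]
      intro κ hκ
      have h := mem_invariants_iff.1 hx _ (conj_mem_conj K g hκ)
      calc ρ κ (ρ g⁻¹ x) = ρ g⁻¹ (ρ (g * κ * g⁻¹) x) := by
            simp only [map_mul, Module.End.mul_apply]
            rw [inv_apply_apply]
        _ = ρ g⁻¹ x := by rw [h]
    · exact apply_inv_apply ρ g x

/-- `ρ g` restricts to an isomorphism `V^K ≃ V^{K^g}`. -/
noncomputable def invariantsConjEquiv :
    invariants ρ K ≃ₗ[k] invariants ρ (K.map (MulAut.conj g).toMonoidHom) :=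
  ((LinearMap.GeneralLinearGroup.toLinearEquiv (ρ.asGroupHom g)).submoduleMap
    (invariants ρ K)).trans (LinearEquiv.ofEq
      ((invariants ρ K).map
        ((LinearMap.GeneralLinearGroup.toLinearEquiv (ρ.asGroupHom g) : V ≃ₗ[k] V) : V →ₗ[k] V))
      (invariants ρ (K.map (MulAut.conj g).toMonoidHom)) (by
      rw [← map_invariants_conj ρ K g]
      congr 1))

/-- `dim V^{K^g} = dim V^K`. -/
theorem finrank_invariants_conj :
    Module.finrank k (invariants ρ (K.map (MulAut.conj g).toMonoidHom)) =
      Module.finrank k (invariants ρ K) :=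
  (invariantsConjEquiv ρ K g).finrank_eq.symm

/-- `ρ g` carries the augmentation submodule `V(K)` into `V(K^g)`. -/
theorem map_coinvariantsKer_conj_le :
    (Coinvariants.ker (restrict ρ K)).map (ρ g) ≤
      Coinvariants.ker (restrict ρ (K.map (MulAut.conj g).toMonoidHom)) := by
  rw [Coinvariants.ker, Submodule.map_span_le]
  rintro _ ⟨⟨κ, v⟩, rfl⟩
  have h : ρ g ((restrict ρ K) κ v - v) = ρ (g * κ * g⁻¹) (ρ g v) - ρ g v := by
    rw [map_sub]
    congr 1
    simp only [map_mul, Module.End.mul_apply]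
    rw [inv_apply_apply]
    rfl
  rw [h]
  exact sub_mem_coinvariantsKer ρ (conj_mem_conj K g κ.2) (ρ g v)

variable {K}

/-- `e_K x` is the unique `K`-invariant vector `y` with `x − y ∈ V(K)`
(`K`-finite `ρ`, characteristic `0`). -/
theorem levelAverage_eq_of_mem_of_sub_mem [CharZero k] (hK : KFinite ρ K) {x y : V}
    (hy : y ∈ invariants ρ K) (hxy : x - y ∈ Coinvariants.ker (restrict ρ K)) :
    levelAverage ρ K x = y := by
  have h1 : levelAverage ρ K (x - y) = 0 := by
    have := coinvariantsKer_le_ker ρ hK hxy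
    rwa [LinearMap.mem_ker, levelIdempotent_apply] at this
  have h2 : levelAverage ρ K x = levelAverage ρ K (x - y) + levelAverage ρ K y := by
    have := map_add (levelIdempotent K hK) (x - y) y
    rw [sub_add_cancel] at this
    simpa only [levelIdempotent_apply] using this
  rw [h2, h1, zero_add, levelAverage_of_mem_invariants hy]

/-- The level idempotents are conjugate: `e_{K^g} (ρ g v) = ρ g (e_K v)`
(`K`-finite `K` and `K^g`, characteristic `0`). -/
theorem levelAverage_conj [CharZero k] (hK : KFinite ρ K)
    (hK' : KFinite ρ (K.map (MulAut.conj g).toMonoidHom)) (v : V) :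
    levelAverage ρ (K.map (MulAut.conj g).toMonoidHom) (ρ g v) = ρ g (levelAverage ρ K v) := by
  haveI := hK v
  refine levelAverage_eq_of_mem_of_sub_mem ρ hK'
    (apply_mem_invariants_conj ρ K g levelAverage_mem_invariants) ?_
  rw [← map_sub]
  exact map_coinvariantsKer_conj_le ρ K g
    (Submodule.mem_map_of_mem (sub_levelAverage_mem_coinvariantsKer ρ (K := K) (v := v)))

end Summit.Ventures.HodgeRepro2.T5LevelConjugation
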